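import Summits.HubbardSuperconductivity.HubbardSuperconductivity.Theorems.WeakCouplingBCSKlStairCertsA
import Summits.HubbardSuperconductivity.HubbardSuperconductivity.Theorems.WeakCouplingBCSKlStairCertsB

/-!
# KL-MARGIN-SCAN reader hubbard-klscan-idea-4, round 9 — order-ideal staircase certificates, part 5/5 (§8–§10: the tube-edge facts of the iso-density lines, the van Hove dopings, the scan words)

CUSTOMERS of the certificates of parts 3–4: §8 the four HYPOTHESES of round 8 (`KlLevelMotion.line_d0125_zones_of_edges`, `branches_of_edges`,
`line_d035_all_Gamma_of_edge`) discharged — `vhLevel_d0125_Medge`, `vhLevel_d0125_Gedge`, `vhLevel_m03_Gedge`, hence `line_d0125_zones`,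
`line_d0125_halflines`, `line_d030_all_Gamma`, `line_d035_all_Gamma` unconditionally; §9 kernel brackets `δ_VH(−0.1) ∈ (0.0769, 0.087]`,
`δ_VH(−0.2) ∈ (0.1651, 0.175]`, `δ_VH(−0.3) ∈ (0.2689, 0.2784]`; §10 the side / VH-admissibility words of 27 of the 28 cells of SCAN-TABLE v0.2
as quadrant theorems (`column_0_cells` from the tree's `muWinD005_filling_ge`; `column_m01/m02/m03_cells`; `cell_d010_m01_excluded`); the word
«(0.15, −0.2) VH-excluded» is NOT certified (filling slack 0.00035). Thesis and cascade finding: part 1 `WeakCouplingBCSKlStairCore`.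

HONEST FRAMING. Free-band filling geometry of `squareDispersion 1 t′` only; floats quoted in docstrings are floats; nothing here asserts a KL
margin at `t′ ≠ 0`, `K₃`, the window or superconductivity; a Kohn–Luttinger `O(U²)` channel statement is not ODLRO; nothing proves superconductivity
in the Hubbard model; no `t′ ≠ 0` statement chains to the summit Statement. 0 kit · 0 sorry.
-/

noncomputable section

-- the tree's namespace `Summit.<Summit>.<Problem>.Theorems` repeats the summit name by design (D-0017); same line as in the
-- landed siblings `KLProgrammeMuOfDopingWindowFillingD005Lower` / `WeakCouplingBCSKlIsoDensityLevelMotion`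
set_option linter.dupNamespace false

namespace Summit.HubbardSuperconductivity.HubbardSuperconductivity.Theorems.KlStair

open Real Set MeasureTheory Literature.MathematicalPhysics.QuantumLattice
open Summit.HubbardSuperconductivity.HubbardSuperconductivity.Theorems
open Summit.HubbardSuperconductivity.HubbardSuperconductivity.Theorems.FSPoly (cosLoQ cosUpQ piLoQ cosLoQ_le_cos cos_le_cosUpQ)
open Summit.HubbardSuperconductivity.HubbardSuperconductivity.Theorems.KlLevelMotion

/-! ### §8  The tube-edge facts of round 8 as theorems; the lines `δ = ⅛, 3/10, 7/20` decided unconditionally -/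

/-- **F1 ⇒ the `M`-edge of the line `δ = ⅛`**: `1/40 ≤ d̃(⅛; −9/50)` (`n[ε_{−0.18}](−0.695) < 7/8`, so `−0.695 ≤ μ(⅛; −0.18)`). [folklore] -/
theorem vhLevel_d0125_Medge : 1 / 40 ≤ vhLevel (-9 / 50) (1 / 8) := by
  have h := filling_lt_F1
  push_cast at h
  have hμ : -139 / 200 ≤ klMuOfDopingTP (-9 / 50) (1 / 8) :=
    le_muOfDoping_of_filling_lt (by norm_num) (by norm_num at h ⊢; exact h)
  unfold vhLevel klVanHoveLevelTP; linarith

/-- **F2 ⇒ the `Γ`-edge of the line `δ = ⅛`**: `d̃(⅛; −3/25) ≤ −1/40` (`7/8 ≤ n[ε_{−0.12}](−0.505)`, so `μ(⅛; −0.12) ≤ −0.505`). [folklore] -/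
theorem vhLevel_d0125_Gedge : vhLevel (-3 / 25) (1 / 8) ≤ -(1 / 40) := by
  have h := filling_ge_F2
  push_cast at h
  have hμ : klMuOfDopingTP (-3 / 25) (1 / 8) ≤ -101 / 200 :=
    muOfDoping_le_of_le_filling (by norm_num) (by norm_num at h ⊢; exact h)
  unfold vhLevel klVanHoveLevelTP; linarith

/-- **G3 ⇒ the `Γ`-tube edge of the whole column `t′ = −3/10` above `δ = 3/10`**: `d̃(δ; −3/10) ≤ −1/40` for every
`δ ∈ [3/10, 1)` (`7/10 ≤ n[ε_{−0.3}](−1.225)`; slack `0.0013` in filling units, `400` corners). [folklore] -/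
theorem vhLevel_m03_Gedge {δ : ℝ} (hδ : 3 / 10 ≤ δ) (h1 : δ < 1) : vhLevel (-3 / 10) δ ≤ -(1 / 40) := by
  have h := filling_ge_G3
  push_cast at h
  have hμ : klMuOfDopingTP (-3 / 10) δ ≤ -49 / 40 :=
    muOfDoping_le_of_le_filling h1 (by norm_num at h ⊢; linarith)
  unfold vhLevel klVanHoveLevelTP; linarith

/-- **The line `δ = ⅛` decided** (round 8's `line_d0125_zones_of_edges`, now unconditional): every `t′ ∈ [−3/25, 0]` is `Γ`-side
admissible, every `t′ ∈ [−3/10, −9/50]` is `M`-side admissible, and every VH-excluded `t′` of the line lies in `(−9/50, −3/25)`. [folklore] -/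
theorem line_d0125_zones :
    (∀ tp ∈ Icc (-3 / 25 : ℝ) 0, ¬ klVHExcludedTP tp (1 / 8) ∧ vhLevel tp (1 / 8) ≤ -(1 / 40)) ∧
    (∀ tp ∈ Icc (-3 / 10 : ℝ) (-9 / 50), ¬ klVHExcludedTP tp (1 / 8) ∧ 1 / 40 ≤ vhLevel tp (1 / 8)) ∧
    (∀ tp, klVHExcludedTP tp (1 / 8) → tp ∈ Ioo (-9 / 50 : ℝ) (-3 / 25)) :=
  line_d0125_zones_of_edges vhLevel_d0125_Medge vhLevel_d0125_Gedge

/-- **The line `δ = ⅛` on all of `t′ ∈ ℝ`** (round 8's `branches_of_edges`, now unconditional): `M`-side admissible for every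
`t′ ≤ −9/50`, `Γ`-side admissible for every `t′ ≥ −3/25`, VH-excluded only inside `(−9/50, −3/25)`. [folklore] -/
theorem line_d0125_halflines :
    (∀ tp ≤ -9 / 50, ¬ klVHExcludedTP tp (1 / 8) ∧ 1 / 40 ≤ vhLevel tp (1 / 8)) ∧
    (∀ tp ≥ -3 / 25, ¬ klVHExcludedTP tp (1 / 8) ∧ vhLevel tp (1 / 8) ≤ -(1 / 40)) ∧
    (∀ tp, klVHExcludedTP tp (1 / 8) → tp ∈ Ioo (-9 / 50 : ℝ) (-3 / 25)) :=
  branches_of_edges (by norm_num) (by norm_num) vhLevel_d0125_Medge vhLevel_d0125_Gedge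

/-- **The line `δ = 7/20` decided**: `Γ`-side and admissible for every `t′ ∈ [−3/10, 0]` (round 8's `line_d035_all_Gamma_of_edge`,
now unconditional). [folklore] -/
theorem line_d035_all_Gamma : ∀ tp ∈ Icc (-3 / 10 : ℝ) 0, ¬ klVHExcludedTP tp (7 / 20) ∧ vhLevel tp (7 / 20) ≤ -(1 / 40) :=
  line_d035_all_Gamma_of_edge (vhLevel_m03_Gedge (by norm_num) (by norm_num))

/-- **The line `δ = 3/10` decided**: `Γ`-side and admissible for every `t′ ≥ −3/10`. [folklore] -/
theorem line_d030_all_Gamma : ∀ tp : ℝ, -3 / 10 ≤ tp → ¬ klVHExcludedTP tp (3 / 10) ∧ vhLevel tp (3 / 10) ≤ -(1 / 40) :=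
  fun _ htp => not_excluded_of_Gedge (by norm_num) (by norm_num) (vhLevel_m03_Gedge (by norm_num) (by norm_num)) htp

/-! ### §9  Kernel brackets of the van Hove dopings `δ_VH(t′) = 1 − n[ε_{t′}](4t′)` of the three scan columns -/

/-- **`δ_VH(−1/10) ∈ (0.0769, 0.087]`**, i.e. `0.913 ≤ n[ε_{−0.1}](−0.4) < 0.9231` (two staircases of `199`/`200` corners;
float value `0.08198`, margin-1 g14 `[0.081976, 0.081979]`). [folklore] -/
theorem vanHoveDoping_m01 : 769 / 10000 < klVanHoveDopingTP (-1 / 10) ∧ klVanHoveDopingTP (-1 / 10) ≤ 87 / 1000 := by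
  have h1 := filling_ge_V1i; have h2 := filling_lt_V1o
  push_cast at h1 h2
  unfold klVanHoveDopingTP klDopingOfMuTP klVanHoveLevelTP
  norm_num at h1 h2 ⊢; constructor <;> linarith

/-- **`δ_VH(−1/5) ∈ (0.1651, 0.175]`**, i.e. `0.825 ≤ n[ε_{−0.2}](−0.8) < 0.8349` (float value `0.17001`). [folklore] -/
theorem vanHoveDoping_m02 : 1651 / 10000 < klVanHoveDopingTP (-1 / 5) ∧ klVanHoveDopingTP (-1 / 5) ≤ 7 / 40 := by
  have h1 := filling_ge_V2i; have h2 := filling_lt_V2o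
  push_cast at h1 h2
  unfold klVanHoveDopingTP klDopingOfMuTP klVanHoveLevelTP
  norm_num at h1 h2 ⊢; constructor <;> linarith

/-- **`δ_VH(−3/10) ∈ (0.2689, 0.2784]`**, i.e. `0.7216 ≤ n[ε_{−0.3}](−1.2) < 0.7311` (float value `0.27367`). [folklore] -/
theorem vanHoveDoping_m03 : 2689 / 10000 < klVanHoveDopingTP (-3 / 10) ∧ klVanHoveDopingTP (-3 / 10) ≤ 174 / 625 := by
  have h1 := filling_ge_V3i; have h2 := filling_lt_V3o
  push_cast at h1 h2
  unfold klVanHoveDopingTP klDopingOfMuTP klVanHoveLevelTP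
  norm_num at h1 h2 ⊢; constructor <;> linarith

/-! ### §10  The side / admissibility words of the scan grid as theorems (one tube-edge certificate per column and side,
propagated along the iso-density lines by round 8's `not_excluded_of_Gedge` / `not_excluded_of_Medge`) -/

/-- **Column `t′ = −1/10`**: every `δ ∈ [3/20, 1)` is `Γ`-side admissible at every `t′ ≥ −1/10` (`17/20 ≤ n[ε_{−0.1}](−0.425)`), and
every `δ ∈ [−1, 1/20]` is `M`-side admissible at every `t′ ≤ −1/10` (`n[ε_{−0.1}](−0.375) < 19/20`). Scan cells: `(0.05, −0.1)` `M`;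
`(0.15 … 0.35, −0.1)` `Γ`. [folklore] -/
theorem column_m01_cells :
    (∀ δ : ℝ, 3 / 20 ≤ δ → δ < 1 → ∀ tp : ℝ, -1 / 10 ≤ tp → ¬ klVHExcludedTP tp δ ∧ vhLevel tp δ ≤ -(1 / 40)) ∧
    (∀ δ : ℝ, -1 ≤ δ → δ ≤ 1 / 20 → ∀ tp : ℝ, tp ≤ -1 / 10 → ¬ klVHExcludedTP tp δ ∧ 1 / 40 ≤ vhLevel tp δ) := by
  have hG := filling_ge_G1; have hM := filling_lt_M1
  push_cast at hG hM; norm_num at hG hM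
  refine ⟨fun δ hδ h1 tp htp => ?_, fun δ h2 hδ tp htp => ?_⟩
  · have hμ : klMuOfDopingTP (-1 / 10) δ ≤ -17 / 40 := muOfDoping_le_of_le_filling h1 (by norm_num at hG ⊢; linarith)
    have hedge : vhLevel (-1 / 10) δ ≤ -(1 / 40) := by unfold vhLevel klVanHoveLevelTP; linarith
    exact not_excluded_of_Gedge h1 (by linarith) hedge htp
  · have hμ : -3 / 8 ≤ klMuOfDopingTP (-1 / 10) δ := le_muOfDoping_of_filling_lt h2 (by norm_num at hM ⊢; linarith)
    have hedge : 1 / 40 ≤ vhLevel (-1 / 10) δ := by unfold vhLevel klVanHoveLevelTP; linarith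
    exact not_excluded_of_Medge (by linarith) h2 hedge htp

/-- **Column `t′ = −1/5`**: every `δ ∈ [1/5, 1)` is `Γ`-side admissible at every `t′ ≥ −1/5` (`4/5 ≤ n[ε_{−0.2}](−0.825)`, slack `0.004`),
and every `δ ∈ [−1, 1/10]` is `M`-side admissible at every `t′ ≤ −1/5` (`n[ε_{−0.2}](−0.775) < 9/10`). Scan cells: `(0.05, 0.10; −0.2)` `M`;
`(0.20 … 0.35; −0.2)` `Γ`. [folklore] -/
theorem column_m02_cells :
    (∀ δ : ℝ, 1 / 5 ≤ δ → δ < 1 → ∀ tp : ℝ, -1 / 5 ≤ tp → ¬ klVHExcludedTP tp δ ∧ vhLevel tp δ ≤ -(1 / 40)) ∧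
    (∀ δ : ℝ, -1 ≤ δ → δ ≤ 1 / 10 → ∀ tp : ℝ, tp ≤ -1 / 5 → ¬ klVHExcludedTP tp δ ∧ 1 / 40 ≤ vhLevel tp δ) := by
  have hG := filling_ge_G2; have hM := filling_lt_M2
  push_cast at hG hM; norm_num at hG hM
  refine ⟨fun δ hδ h1 tp htp => ?_, fun δ h2 hδ tp htp => ?_⟩
  · have hμ : klMuOfDopingTP (-1 / 5) δ ≤ -33 / 40 := muOfDoping_le_of_le_filling h1 (by norm_num at hG ⊢; linarith)
    have hedge : vhLevel (-1 / 5) δ ≤ -(1 / 40) := by unfold vhLevel klVanHoveLevelTP; linarith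
    exact not_excluded_of_Gedge h1 (by linarith) hedge htp
  · have hμ : -31 / 40 ≤ klMuOfDopingTP (-1 / 5) δ := le_muOfDoping_of_filling_lt h2 (by norm_num at hM ⊢; linarith)
    have hedge : 1 / 40 ≤ vhLevel (-1 / 5) δ := by unfold vhLevel klVanHoveLevelTP; linarith
    exact not_excluded_of_Medge (by linarith) h2 hedge htp

/-- **Column `t′ = −3/10`**: every `δ ∈ [3/10, 1)` is `Γ`-side admissible at every `t′ ≥ −3/10` (certificate `G3`, slack `0.0013`), and
every `δ ∈ [−1, 1/4]` is `M`-side admissible at every `t′ ≤ −3/10` (`n[ε_{−0.3}](−1.175) < 3/4`, the tight cell `(0.25, −0.3)`: slack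
`0.0006`, `1400` corners). Scan cells: `(0.05 … 0.25; −0.3)` `M`; `(0.30, 0.35; −0.3)` `Γ`. [folklore] -/
theorem column_m03_cells :
    (∀ δ : ℝ, 3 / 10 ≤ δ → δ < 1 → ∀ tp : ℝ, -3 / 10 ≤ tp → ¬ klVHExcludedTP tp δ ∧ vhLevel tp δ ≤ -(1 / 40)) ∧
    (∀ δ : ℝ, -1 ≤ δ → δ ≤ 1 / 4 → ∀ tp : ℝ, tp ≤ -3 / 10 → ¬ klVHExcludedTP tp δ ∧ 1 / 40 ≤ vhLevel tp δ) := by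
  have hM := filling_lt_M3
  push_cast at hM; norm_num at hM
  refine ⟨fun δ hδ h1 tp htp => not_excluded_of_Gedge h1 (by linarith) (vhLevel_m03_Gedge hδ h1) htp, fun δ h2 hδ tp htp => ?_⟩
  have hμ : -47 / 40 ≤ klMuOfDopingTP (-3 / 10) δ := le_muOfDoping_of_filling_lt h2 (by norm_num at hM ⊢; linarith)
  have hedge : 1 / 40 ≤ vhLevel (-3 / 10) δ := by unfold vhLevel klVanHoveLevelTP; linarith
  exact not_excluded_of_Medge (by linarith) h2 hedge htp

/-- **Column `t′ = 0`** (no new certificate: the tree's `muWinD005_filling_ge`, `19/20 ≤ n[ε₀](−3/40)`): every `δ ∈ [1/20, 1)` is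
`Γ`-side admissible at every `t′ ≥ 0`, with `d̃ ≤ −3/40`at `t′ = 0`. Scan cells: the whole `t′ = 0` column `Γ`. [folklore] -/
theorem column_0_cells :
    ∀ δ : ℝ, 1 / 20 ≤ δ → δ < 1 → vhLevel 0 δ ≤ -(3 / 40) ∧ ∀ tp : ℝ, 0 ≤ tp → ¬ klVHExcludedTP tp δ ∧ vhLevel tp δ ≤ -(1 / 40) := by
  intro δ hδ h1
  have h0 := muWinD005_filling_ge
  have hμ : klMuOfDopingTP 0 δ ≤ -(3 : ℝ) / 40 := muOfDoping_le_of_le_filling h1 (by linarith)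
  have hedge : vhLevel 0 δ ≤ -(3 / 40) := by unfold vhLevel klVanHoveLevelTP; linarith
  exact ⟨hedge, fun tp htp => not_excluded_of_Gedge h1 (by linarith) (by linarith) htp⟩

/-- **The VH-excluded word of the cell `(δ, t′) = (1/10, −1/10)` certified**: `−0.0249 ≤ d̃(1/10; −1/10) ≤ 0`, hence
`|d̃| < 1/40` (`n[ε_{−0.1}](−0.4249) < 9/10` by `1200` outer corners, slack `0.0012`; and `9/10 ≤ 0.913 ≤ n[ε_{−0.1}](−0.4)` from `V1i`).
The other excluded word of the scan, `(0.15, −0.2)` (float `d̃ = +0.0245`, slack `0.00035`), is NOT certified here. [folklore] -/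
theorem cell_d010_m01_excluded : klVHExcludedTP (-1 / 10) (1 / 10) ∧ -(249 / 10000) ≤ vhLevel (-1 / 10) (1 / 10) ∧ vhLevel (-1 / 10) (1 / 10) ≤ 0 := by
  have hX := filling_lt_X1; have hV := filling_ge_V1i
  push_cast at hX hV; norm_num at hX hV
  have hlo : -4249 / 10000 ≤ klMuOfDopingTP (-1 / 10) (1 / 10) := le_muOfDoping_of_filling_lt (by norm_num) (by norm_num at hX ⊢; linarith)
  have hhi : klMuOfDopingTP (-1 / 10) (1 / 10) ≤ -2 / 5 := muOfDoping_le_of_le_filling (by norm_num) (by norm_num at hV ⊢; linarith)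
  have h1 : -(249 / 10000) ≤ vhLevel (-1 / 10) (1 / 10) := by unfold vhLevel klVanHoveLevelTP; linarith
  have h2 : vhLevel (-1 / 10) (1 / 10) ≤ 0 := by unfold vhLevel klVanHoveLevelTP; linarith
  exact ⟨(vhExcluded_iff _ _).2 (abs_lt.2 ⟨by linarith, by linarith⟩), h1, h2⟩

end Summit.HubbardSuperconductivity.HubbardSuperconductivity.Theorems.KlStair
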